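import Literature.NumberTheory.EllipticCurves.PadicSigmaSq
import Literature.NumberTheory.EllipticCurves.QuadraticTwist
import HarnessLib

/-!
# The sigma-squared `p`-adic height READ THROUGH A QUADRATIC TWIST: the `x⁻¹`-expansion `𝔖_p` of
# `Σ_p`, and the receptacle `PAdicHeightData.IsCanonicalSqMinusTwist` for the minus part
# `V^{(d)}(ℚ) = V(ℚ(√d))⁻` — DEFINITIONS ONLY (no named fact, nothing asserted; net debt `0`)

Topic `Literature/NumberTheory/EllipticCurves` (trunk T-NT-EC); sibling of `PadicSigmaSq.lean`
(`padicSigmaSq = Σ_p = σ_p²`, `canonicalPAdicHeightSq`, `PAdicHeightData.IsCanonicalSq`,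
`PAdicHeightDataK.IsCanonicalSq`) and `QuadraticTwist.lean` (`WeierstrassCurve.quadraticTwist`).
Typer seat `bsd-print-cf2-ty2` (g49) of the cell `bsd-print-cf2` (HOME
`run/shared/lean/pub/bsd-print-cf2/`), SUMMON (U5d) of the planner (g24, 2026-08-30T16:26:28Z, on the
width seat -w8 g19's finding 16:25:50Z; designs (α)/(β) recorded there), for road (C)
`disegni-pair-two` of the crux `PrintCf2.SplitBadTwoRankOneOfFacts`. BSD is not proved by any of this.

## Why (the vocabulary gap this file closes)

The tree pins THE canonical cyclotomic `p`-adic height in sigma(-squared) form in two receptacles: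
`PAdicHeightData.IsCanonicalSq D` for `ℚ`-points of a curve GOOD (ordinary) at `p`
(`⟨P,P⟩ = log_p den x(P) − log_p Σ_p(z(P))`), and `PAdicHeightDataK.IsCanonicalSq DK` for points over
a number field `K` in which `p` is TOTALLY SPLIT (one term per embedding `K → ℚ_p`). Road (C) reads
the `2`-adic height of the generator `P` of `W(ℚ)`, `W = V^{(d)}` the quadratic twist by
`d ∈ {−1, ±2}` of `V = 49a1^{(d′)}` (good ORDINARY at `2`): `W` is ADDITIVE at `2` (first receptacle
unavailable) and the point `P′ ∈ V(F′)` corresponding to `P`, `F′ = ℚ(√d)`, lives over a field in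
which `2` RAMIFIES (second receptacle unavailable: `Fintype.card (F′ →+* ℚ₂) = 0 < 2`). Bertrand's
non-vanishing theorem (Bertrand 1984 Cor. 1, the cell's (Δ3)) is about exactly this height: `V` has
CM and good ordinary reduction above `2`, `P′ ∈ V(F′)`. The observation (planner / -w8 g19): the
local sigma term at the ramified place is a `ℚ₂`-VALUE computable from the RATIONAL number `x(P′)`,
because `Σ = σ²` is invariant under the formal inverse and `conj P′ = −P′`. This file types that
observation as definitions; existence/pinning theorems (the analogue of
`cm7Twist_existsUnique_isCanonicalSq_two`) are left to provers.

## The mathematics (all classical; [cite]s on the declarations)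

* `1/x(z) = w(z)/z = z²·(w/z³) ∈ R⟦z⟧` (`formalInvX`; Silverman AEC IV.1: `x = z/w`), invariant under
  the formal inverse `i` (`x∘[−1] = x`), with a double zero. By Weierstrass preparation `z` is
  quadratic over `R⟦1/x⟧` with conjugate `i(z)`, so the `i`-invariant series are exactly the series
  in `1/x`: every EVEN `Σ` (`IsFormallyEven`: `Σ(i(z)) = Σ(z)` — the square of the Mazur–Tate-odd `σ`,
  Silverman 2005 §5 Rem. 2: at `p = 2` only `σ²` is well defined) is `𝔖(1/x(z))` for a unique
  `𝔖 ∈ R⟦w⟧`, `𝔖 = w + O(w²)` (`IsInvXExpansion`; `padicSigmaSqInvX V p = 𝔖_p` for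
  `Σ_p = padicSigmaSq (V ⊗ ℚ_p)`, chosen by `Classical.choose`, junk `0` if `Σ_p` is not even). Hence
  for a point `Q` in the formal group at a place above `p` of ANY `p`-adic field, `Σ_p(z(Q)) =
  𝔖_p(1/x(Q))` — a function of `x(Q)` alone.
* THE TWIST. The tree's model `V.quadraticTwist d : y² = x³ + d(b₂/4)x² + d²(b₄/2)x + d³(b₆/4)` is the
  completed-square model `v² = f(u) = u³ + (b₂/4)u² + (b₄/2)u + b₆/4` of `V` (`v = y + (a₁x + a₃)/2`,
  `u = x`) twisted by `d` and rescaled by `(u, v) ↦ (du, d²v)`. So `P = (X, Y) ∈ V^{(d)}(ℚ)` gives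
  `d·(Y/d²)² = f(X/d)`, i.e. the point `P′ = (X/d, (Y/d²)√d − (a₁X/d + a₃)/2) ∈ V(F′)`, `F′ = ℚ(√d)`,
  with `conj P′ = −P′` (`−(x,y) = (x, −y − a₁x − a₃)`) and RATIONAL `x(P′) = X/d` (`minusTwistX`).
* THE LOCAL TERM AT `p` (one place `𝔓` of `F′` above `p`, `[F′_𝔓 : ℚ_p] = 2`, i.e. `p` ramified or
  inert in `F′`): `N_{F′_𝔓/ℚ_p} Σ_p(z(P′)) = Σ_p(z)·Σ_p(z̄)` and `z̄ = z(conj P′) = z(−P′) = i(z)`, so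
  `= Σ_p(z)·Σ_p(i(z)) = Σ_p(z)² = 𝔖_p(1/x(P′))²` with `𝔖_p(1/x(P′)) ∈ ℚ_p` (`x(P′) ∈ ℚ`). For `p`
  split in `F′` the two places contribute `𝔖_p(1/x(P′))` each. Either way
  `Σ_{𝔓∣p} log_p N_𝔓 Σ_p(z_𝔓(P′)) = 2·log_p 𝔖_p(1/x(P′))`.
* THE HEIGHT. In the tree's Sq normalisation over a number field (`canonicalPAdicHeightSqK`:
  `log_p N𝔡(x) − Σ_places log_p NΣ_p(z)`, Balakrishnan–Çiperiani–Stein 2015 §4.1 (4.1) / Stein–Wuthrich,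
  `= −2p ×` Mazur–Stein–Tate's `h_p`), for `P′` admissible: `h^{Sq}_{V/F′}(P′) = log_p(den x(P′))² −
  2 log_p 𝔖_p(1/x(P′))` (`x(P′) ∈ ℚ`: `N_{F′/ℚ}𝔡(x′) = den(x′)²`). RESTRICTION CONVENTION (the
  defining one of this receptacle, as the SUMMON asks; cf. `PAdicHeightDataK.RestrictsTo`: heights
  over `F′` restrict to points coming from `ℚ` with the factor `[F′:ℚ]`): the height of `P` on the
  `ℚ`-curve `V^{(d)} ≅_{F′} V` is `h_{V^{(d)}/ℚ}(P) := ½·h_{V/F′}(P′) = log_p den(X/d) − log_p 𝔖_p(d/X)`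
  (`canonicalPAdicHeightSqMinusTwist`). At `d = 1` and a `ℚ`-point in the formal group this is
  LITERALLY `canonicalPAdicHeightSq V p` (`𝔖_p(1/x) = Σ_p(z)`): the receptacle extends the tree's one.
* ADMISSIBILITY (`IsAdmissibleMinusTwist` = non-torsion ∧ `MinusTwistLocalConditions`, the analogue of
  the tree's `IsAdmissible` for the `F′`-point `P′` written through `x′ = X/d`): `P′` in the formal
  group at `𝔓 ∣ p` with `z` in the sigma disc (`|z|² = |1/x′|_p`: `‖x′‖_p > 1`,
  `‖1/x′‖_p < p^{−2/(p−1)}`; at `p = 2`: `ord₂ x′ ≤ −3`); non-singular reduction at every ODD prime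
  `ℓ ≠ p`, which on `v² = f(u)` (isomorphic to `V` over `ℤ[1/2]`, so minimal at odd `ℓ` when `V` is)
  reads: `ord_ℓ x′ < 0`, or `f′(x′)` an `ℓ`-unit, or (`ℓ ∤ d`) `f(x′)` an `ℓ`-unit (at `ℓ ∣ d` the
  `y`-coordinate `(Y/d²)√d` reduces to `0`) — `HasNonsingularMinusReductionAt`; and the formal group at
  `2` when `p ≠ 2`. As for `IsAdmissible`, a consumer replaces `P` by `mP` (heights scale by `m²`). The
  model of `V` should be minimal (at least at `p` and at the odd primes), and `V` of good reduction at
  the odd primes dividing `d` (automatic for `d ∈ {−1, ±2}`).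
* THE RECEPTACLE: `PAdicHeightData.IsCanonicalSqMinusTwist (D : PAdicHeightData (V.quadraticTwist d) p)
  := ∀ P admissible, ⟨P,P⟩_D = canonicalPAdicHeightSqMinusTwist V p d P`. A consumer holding its datum
  on another `ℚ`-model `W` of the twist (`C • W = V.quadraticTwist d`, e.g. `cm7.quadraticTwist`)
  transports it along the `ℚ`-isomorphism. For road (C): `V = 49a1^{(d′)}` minimal, `p = 2`,
  `d = d* ∈ {−1, ±2}`; the pinning theorem «∃! D, IsCanonicalSqMinusTwist D ∧ D = Schneider/Mazur–Tate»
  is NOT here (pattern: `cm7Twist_existsUnique_isCanonicalSq_two`), nor is the identification of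
  `Σ₂(V)` with the square of the CM sigma function (`twist_padicSigmaSq_eq_sq_two`,
  `X049TwistCMSigmaSqTwoProofs.lean`) re-proved for `𝔖₂`.

## What is NOT here

No existence/uniqueness of the `x⁻¹`-expansion (an `R⟦1/x⟧`-module computation; prover task), no
integrality of `𝔖_p` (it is in `ℤ_p⟦w⟧` when `Σ_p ∈ ℤ_p⟦z⟧`), no convergence statement, no relation
to `PAdicHeightDataK W p F′` (the tree has no canonical receptacle over `F′` to compare with), no named
fact. `-- TODO(general form): a sigma-squared receptacle for points over an arbitrary number field
-- (local terms log_p N_{K_𝔓/ℚ_p} Σ_p(z_𝔓) at every 𝔓 ∣ p, any splitting behaviour), of which both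
-- PAdicHeightDataK.IsCanonicalSq (p totally split) and this file (x-coordinate rational) are cases.`

## References

* [MazurSteinTate2006] B. Mazur, W. Stein, J. Tate, *Computation of p-adic heights and log
  convergence*, Doc. Math. Extra Vol. Coates (2006), §1 eq. (1.1), Thm. 1.3 (σ odd, σ(P)/d(P)).
* [Silverman2005DivPoly] J. H. Silverman, Math. Ann. 332 (2005) (arXiv math/0404412), §5 Thm. 11 and
  Remark 2 (`σ²` at `p = 2`).
* [BalakrishnanCiperianiStein2015] J. Balakrishnan, M. Çiperiani, W. Stein, *p-adic heights of Heegner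
  points and Λ-adic regulators*, Math. Comp. 84 (2015), §4.1 eq. (4.1) (heights over number fields as
  sums over places).
* [SteinWuthrich2013] W. Stein, C. Wuthrich, Math. Comp. 82 (2013), §4.1 (normalisation, sigma disc).
* [SilvermanAEC2009] J. H. Silverman, *The Arithmetic of Elliptic Curves*, 2nd ed., IV.1 (formal group:
  `x = z/w`, `w/z³`), VII.2/III.1 (reduction, singular points), X.2 Prop. 2.4, X.5 Cor. 5.4 (twists).
* [RubinSilverberg2002] K. Rubin, A. Silverberg, Bull. AMS 39 (2002), §1 (quadratic twists).
* Cell: HOME `bsd-print-cf2-plan/TYPING-BRIEF-disegni-thmAB-g24.md` (§3 seam S3, NOTE on the receptacle),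
  `…/DELTA3-PADIC-HEIGHT-CM-BERTRAND-w5g19.md` §4–§6, `wake/SUMMON-bsd-print-cf2-ty2-…154423Z.md` (U5d).
-/

noncomputable section

open scoped Classical
open PowerSeries Literature.NumberTheory.EllipticCurves

namespace WeierstrassCurve

/-! ### §1 The `x⁻¹`-expansion of an even series (any commutative ring) -/

section Ring

variable {R : Type*} [CommRing R] (W : WeierstrassCurve R)

/-- **`1/x(z)` as a power series in the formal parameter `z = −x/y`**: `x(z) = z/w(z)` (Silverman
AEC IV.1), so `1/x(z) = w(z)/z = z² · (w(z)/z³) = z² + a₁z³ + (a₁² + a₂)z⁴ + ⋯ ∈ R⟦z⟧`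
(`formalWDivCube = w/z³`). It is invariant under the formal inverse `i` (`x ∘ [−1] = x`) and has a
DOUBLE zero, so the `i`-invariant subring of `R⟦z⟧` is `R⟦1/x⟧` (Weierstrass preparation: `z` is
quadratic over `R⟦1/x⟧` with conjugate `i(z)`). [Silverman AEC IV.1, expansions after Prop. 1.1]
[cite: SilvermanAEC2009, IV.1.1] -/
def formalInvX : R⟦X⟧ :=
  X ^ 2 * W.formalWDivCube

/-- **`S` is the `x⁻¹`-EXPANSION of the series `Sq`**: `S(1/x(z)) = Sq(z)` in `R⟦z⟧`
(`PowerSeries.subst` along `formalInvX`, which has zero constant term). Every `i`-INVARIANT series —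
in particular an EVEN sigma-squared `Σ = σ²` (`IsFormallyEven`, `Σ(i(z)) = Σ(z)`) — has exactly one
such expansion, `S = w + O(w²)` for `Σ = z² + ⋯`; an odd `σ` has none. A PREDICATE (existence and
uniqueness are not asserted here). [cite: Silverman2005DivPoly, §5 Rem. 2 (σ² is the well-defined object at p = 2)]
[cite: MazurSteinTate2006, §1 eq. (1.1) and Thm. 1.3 (σ is odd, so σ² is even)] -/
def IsInvXExpansion (Sq S : R⟦X⟧) : Prop :=
  S.subst W.formalInvX = Sq

/-- Unfolding `formalInvX`. [cite: SilvermanAEC2009, IV.1.1] -/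
theorem formalInvX_def : W.formalInvX = X ^ 2 * W.formalWDivCube := rfl

/-- `1/x(z)` has zero constant term (a double zero at `z = 0`). [cite: SilvermanAEC2009, IV.1.1] -/
theorem constantCoeff_formalInvX : constantCoeff W.formalInvX = 0 := by
  simp [formalInvX]

/-- `[z¹](1/x(z)) = 0`. [cite: SilvermanAEC2009, IV.1.1] -/
theorem coeff_one_formalInvX : coeff 1 W.formalInvX = 0 := by
  rw [formalInvX, coeff_X_pow_mul']
  simp

/-- `[z²](1/x(z)) = 1` (`w/z³ = 1 + a₁z + ⋯`). [cite: SilvermanAEC2009, IV.1.1] -/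
theorem coeff_two_formalInvX : coeff 2 W.formalInvX = 1 := by
  rw [formalInvX, coeff_X_pow_mul']
  simp [formalWDivCube, coeff_three_formalW]

/-- `formalInvX` may be substituted into power series (its constant term is nilpotent, being `0`).
[cite: SilvermanAEC2009, IV.1.1] -/
theorem hasSubst_formalInvX : HasSubst W.formalInvX :=
  HasSubst.of_constantCoeff_zero (constantCoeff_formalInvX W)

/-- Unfolding `IsInvXExpansion`. [cite: Silverman2005DivPoly, §5 Rem. 2] -/
theorem isInvXExpansion_iff (Sq S : R⟦X⟧) :
    W.IsInvXExpansion Sq S ↔ S.subst W.formalInvX = Sq := Iff.rfl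

end Ring

/-! ### §2 Over `ℚ_p`: THE `x⁻¹`-expansion `𝔖_p` of `Σ_p` and its values -/

section Padic

variable (V : WeierstrassCurve ℚ) (p : ℕ) [Fact p.Prime]

/-- **`𝔖_p ∈ ℚ_p⟦w⟧`, the `x⁻¹`-expansion of the squared sigma function `Σ_p` of `V ⊗ ℚ_p`**
(`padicSigmaSq`): the series with `𝔖_p(1/x(z)) = Σ_p(z)`, chosen (`Classical.choose`) when it exists
— it does and is unique whenever `Σ_p` is even, e.g. for THE squared Mazur–Tate pair at a good
ordinary `p` (any `p`, `p = 2` included: Silverman 2005 Rem. 2) —, junk `0` otherwise. For a point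
`Q` in the formal group at a place above `p` of ANY `p`-adic field, `Σ_p(z(Q)) = 𝔖_p(1/x(Q))`: the
sigma-squared local term is a function of the `x`-COORDINATE alone.
[cite: Silverman2005DivPoly, §5 Thm. 11 and Rem. 2] [cite: MazurSteinTate2006, Thm. 1.3] -/
def padicSigmaSqInvX : ℚ_[p]⟦X⟧ :=
  if h : ∃ S : ℚ_[p]⟦X⟧, (V.baseChange ℚ_[p]).IsInvXExpansion (V.baseChange ℚ_[p]).padicSigmaSq S
  then h.choose else 0

/-- `𝔖_p(w) ∈ ℚ_p` for `w ∈ ℚ_p` (`padicEval`; convergent for `‖w‖ < 1` when `𝔖_p ∈ ℤ_p⟦w⟧`).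
[cite: Silverman2005DivPoly, §5 Rem. 2] -/
def padicSigmaSqInvXEval (w : ℚ_[p]) : ℚ_[p] :=
  padicEval (V.padicSigmaSqInvX p) w

variable {V p} in
/-- Defining property of `padicSigmaSqInvX` when an `x⁻¹`-expansion exists: `𝔖_p(1/x(z)) = Σ_p(z)`.
[cite: Silverman2005DivPoly, §5 Rem. 2] -/
theorem isInvXExpansion_padicSigmaSqInvX
    (h : ∃ S : ℚ_[p]⟦X⟧, (V.baseChange ℚ_[p]).IsInvXExpansion (V.baseChange ℚ_[p]).padicSigmaSq S) :
    (V.baseChange ℚ_[p]).IsInvXExpansion (V.baseChange ℚ_[p]).padicSigmaSq (V.padicSigmaSqInvX p) := by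
  rw [padicSigmaSqInvX, dif_pos h]
  exact h.choose_spec

end Padic

/-! ### §3 The minus part of a quadratic twist read through the rational `x`-coordinate -/

section MinusTwist

variable (V : WeierstrassCurve ℚ) (p : ℕ) [Fact p.Prime] (d : ℚ)

/-- **The `x`-coordinate ON `V` of the point of `V(ℚ(√d))⁻` attached to `P ∈ V^{(d)}(ℚ)`**: for the
tree's twist model `V.quadraticTwist d : y² = x³ + d(b₂/4)x² + d²(b₄/2)x + d³(b₆/4)` (the
completed-square model `v² = f(u) := u³ + (b₂/4)u² + (b₄/2)u + b₆/4` of `V` twisted and rescaled by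
`(u, v) ↦ (du, d²v)`), the point `P = (X, Y)` corresponds to `P′ = (X/d, (Y/d²)√d − (a₁X/d + a₃)/2)`
on `V` over `F′ = ℚ(√d)` (`d·(Y/d²)² = f(X/d)`), with `conj P′ = −P′` (the minus part) and RATIONAL
`x(P′) = X/d`. This function returns `X/d` (`0` at `O`). [cite: RubinSilverberg2002, §1 (quadratic twists)]
[cite: SilvermanAEC2009, X.2 Prop. 2.4 and X.5 Cor. 5.4] -/
def minusTwistX : (V.quadraticTwist d).toAffine.Point → ℚ
  | .zero => 0
  | .some x _ _ => x / d

/-- **Non-singular reduction, at an odd prime `ℓ ≠ p`, of the `F′`-point `P′ = (x′, v√d − (a₁x′+a₃)/2)`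
of `V` with rational `x`-coordinate `x′` and `d v² = f(x′)`** (`f` the completed cubic of `V`), at the
primes of `F′ = ℚ(√d)` above `ℓ`, in terms of `x′` alone: either `ord_ℓ x′ < 0` (`P′` reduces to `O`),
or `f′(x′)` is an `ℓ`-adic unit, or `ℓ ∤ d` and `f(x′)` is an `ℓ`-adic unit (then `ȳ ≠ 0`; at `ℓ ∣ d`
the `y`-coordinate `v√d` reduces to `0` and only `f′(x′) ≢ 0` helps). Meaningful for the model of `V`
minimal at `ℓ` and `V` of good reduction at the odd primes dividing `d` (so that the model stays
minimal over the ramified completion); `ℓ = 2 ≠ p` is treated separately (formal group only).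
[cite: MazurSteinTate2006, §1 («reduces to the connected component of 𝓔_{𝔽_ℓ} at all primes ℓ»)]
[cite: SilvermanAEC2009, VII.2 and III.1 (singular points: y = 0 = f′(x) on v² = f(u))] -/
def HasNonsingularMinusReductionAt (ℓ : ℕ) (x' : ℚ) : Prop :=
  let f : ℚ := x' ^ 3 + V.b₂ / 4 * x' ^ 2 + V.b₄ / 2 * x' + V.b₆ / 4
  let f' : ℚ := 3 * x' ^ 2 + V.b₂ / 2 * x' + V.b₄ / 2
  padicValRat ℓ x' < 0 ∨ (f' ≠ 0 ∧ padicValRat ℓ f' = 0) ∨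
    (padicValRat ℓ d = 0 ∧ f ≠ 0 ∧ padicValRat ℓ f = 0)

/-- **The local conditions on `P ∈ V^{(d)}(ℚ)` for the twisted sigma-squared formula** (the
analogue of the tree's `SatisfiesLocalConditions` for the `F′`-point `P′`, `F′ = ℚ(√d)`, stated
through `x′ = x(P′) = X/d ∈ ℚ`): `P′` in the formal group at the place(s) above `p` WITH `z(P′)` in
the sigma disc — `|z|² = |1/x′|_p`, so: `‖x′‖_p > 1` and `‖(x′)⁻¹‖_p < p^{−2/(p−1)}` (at `p = 2`:
`ord₂ x′ ≤ −3`); non-singular reduction of `P′` at every odd prime `ℓ ≠ p`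
(`HasNonsingularMinusReductionAt`); and `P′` in the formal group at `2` if `p ≠ 2`.
[cite: MazurSteinTate2006, §1] [cite: SteinWuthrich2013, §4.1 (range of convergence of σ)] -/
def MinusTwistLocalConditions : (V.quadraticTwist d).toAffine.Point → Prop
  | .zero => False
  | .some x _ _ =>
      1 < ‖((x / d : ℚ) : ℚ_[p])‖ ∧
        ‖(((x / d : ℚ) : ℚ_[p]))⁻¹‖ < (p : ℝ) ^ (-(2 / ((p : ℝ) - 1))) ∧
        (∀ ℓ : ℕ, ℓ.Prime → ℓ ≠ p → ℓ ≠ 2 → V.HasNonsingularMinusReductionAt d ℓ (x / d)) ∧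
        (p ≠ 2 → padicValRat 2 (x / d) < 0)

/-- **Admissible points of `V^{(d)}(ℚ)`**: non-torsion points satisfying the local conditions (a
consumer replaces `P` by a suitable multiple `mP` to get here; heights scale by `m²`).
[cite: MazurSteinTate2006, §1 («a non-torsion point that reduces to 0 ∈ E(𝔽_p) and to the connected component … at all primes»)] -/
def IsAdmissibleMinusTwist (P : (V.quadraticTwist d).toAffine.Point) : Prop :=
  ¬ IsOfFinAddOrder P ∧ V.MinusTwistLocalConditions p d P

/-- **The sigma-squared `p`-adic height of `P ∈ V^{(d)}(ℚ)` READ ON `V` OVER `F′ = ℚ(√d)`**, in the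
tree's normalisation (`canonicalPAdicHeightSq`: `log_p den x − log_p Σ_p(z)`, Stein–Wuthrich /
`−2p`·MST) and with the RESTRICTION CONVENTION `h_{V^{(d)}/ℚ}(P) := ½ · h_{V/F′}(P′)` (heights over
`F′` are sums over the places of `F′`, so a point coming from `ℚ` — here: from the `ℚ`-curve
`V^{(d)} ≅_{F′} V` — acquires the factor `[F′:ℚ] = 2`; cf. `PAdicHeightDataK.RestrictsTo`):
`log_p den(x′) − log_p 𝔖_p(1/x′)`, `x′ = X/d = x(P′) ∈ ℚ`. DERIVATION (for `p` ramified or inert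
in `F′`, one place `𝔓`, `[F′_𝔓 : ℚ_p] = 2`): `½·[log_p N_{F′/ℚ}𝔡(x′) − log_p N_{F′_𝔓/ℚ_p} Σ_p(z_𝔓(P′))]`
with `N𝔡(x′) = den(x′)²` (`x′ ∈ ℚ`) and `N Σ_p(z) = Σ_p(z)·Σ_p(z̄) = Σ_p(z)·Σ_p(i(z)) = Σ_p(z)²`
(`conj P′ = −P′`, `Σ_p` EVEN with `ℚ_p`-coefficients), `Σ_p(z) = 𝔖_p(1/x(P′)) ∈ ℚ_p` — the ramified
local term is a `ℚ_p`-VALUE computed from `x′ ∈ ℚ` without adjoining `√d` (for `p` split in `F′` the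
two places give the same total). At `d = 1` and a `ℚ`-point in the formal group this is literally
`canonicalPAdicHeightSq V p` (`𝔖_p(1/x) = Σ_p(z)`). Junk off the admissible locus; `0` at `O`.
[cite: MazurSteinTate2006, §1 eq. (1.1)] [cite: BalakrishnanCiperianiStein2015, §4.1 eq. (4.1) (the height over a number field as a sum over its places)]
[cite: Silverman2005DivPoly, §5 Rem. 2] -/
def canonicalPAdicHeightSqMinusTwist : (V.quadraticTwist d).toAffine.Point → ℚ_[p]
  | .zero => 0
  | .some x _ _ =>
      padicLog p (((x / d : ℚ).den : ℚ) : ℚ_[p]) -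
        padicLog p (V.padicSigmaSqInvXEval p (((x / d : ℚ) : ℚ_[p]))⁻¹)

variable {V p d} in
/-- **`D` is THE canonical cyclotomic `p`-adic height pairing on `V^{(d)}(ℚ)`, sigma-squared form READ
THROUGH THE TWIST** — the receptacle for a quadratic twist `V^{(d)}` that is ADDITIVE (potentially good
ordinary) at `p` of a curve `V` GOOD ORDINARY at `p`, with `p` RAMIFIED (or inert) in `F′ = ℚ(√d)`
(road (C) of cell `bsd-print-cf2`: `V = 49a1^{(d′)}`, `p = 2`, `d ∈ {−1, ±2}`), where the tree's
`PAdicHeightData.IsCanonicalSq` (needs `V^{(d)}` good at `p`) and `PAdicHeightDataK.IsCanonicalSq`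
over `F′` (needs `p` totally split in `F′`) are both unavailable: on every admissible `P`,
`⟨P, P⟩_D = log_p den x(P′) − log_p 𝔖_p(1/x(P′))` (`canonicalPAdicHeightSqMinusTwist`), i.e. `D` is
half the Schneider / Mazur–Tate height of `V` over `F′` on the minus part, in the tree's Sq
normalisation. A PREDICATE on a `ℚ`-datum of the twist model `V.quadraticTwist d` (transport to
another `ℚ`-model of the twist is by the `ℚ`-isomorphism); nothing is asserted — that this IS the
canonical height (Mazur–Tate σ at good ordinary `p` incl. `2`, Schneider's norm-adapted height,
restriction functoriality) is carried by each consumer fact's citation, as for `IsCanonicalSq`.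
[cite: MazurSteinTate2006, §1 eq. (1.1), Thm. 1.3] [cite: Silverman2005DivPoly, §5 Rem. 2]
[cite: BalakrishnanCiperianiStein2015, §4.1 eq. (4.1)] -/
def PAdicHeightData.IsCanonicalSqMinusTwist (D : PAdicHeightData (V.quadraticTwist d) p) : Prop :=
  ∀ P : (V.quadraticTwist d).toAffine.Point, V.IsAdmissibleMinusTwist p d P →
    D.pairing P P = V.canonicalPAdicHeightSqMinusTwist p d P

/-! #### API -/

/-- `x(P′) = X/d` on an affine point. [cite: RubinSilverberg2002, §1] -/
theorem minusTwistX_some {x y : ℚ} (h : (V.quadraticTwist d).toAffine.Nonsingular x y) :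
    V.minusTwistX d (.some x y h) = x / d := rfl

/-- `x(O) := 0` (junk). [cite: RubinSilverberg2002, §1] -/
@[simp] theorem minusTwistX_zero : V.minusTwistX d 0 = 0 := rfl

/-- The point at infinity is not admissible. [cite: MazurSteinTate2006, §1] -/
@[simp] theorem not_isAdmissibleMinusTwist_zero : ¬ V.IsAdmissibleMinusTwist p d 0 :=
  fun h => h.2

/-- The twisted sigma-squared height of `O` is `0` (the tree's convention at `O`).
[cite: MazurSteinTate2006, §1 eq. (1.1)] -/
@[simp] theorem canonicalPAdicHeightSqMinusTwist_zero :
    V.canonicalPAdicHeightSqMinusTwist p d 0 = 0 := rfl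

/-- Unfolding on an affine point: `log_p den(X/d) − log_p 𝔖_p((X/d)⁻¹)`.
[cite: MazurSteinTate2006, §1 eq. (1.1)] [cite: Silverman2005DivPoly, §5 Rem. 2] -/
theorem canonicalPAdicHeightSqMinusTwist_some {x y : ℚ}
    (h : (V.quadraticTwist d).toAffine.Nonsingular x y) :
    V.canonicalPAdicHeightSqMinusTwist p d (.some x y h) =
      padicLog p (((x / d : ℚ).den : ℚ) : ℚ_[p]) -
        padicLog p (V.padicSigmaSqInvXEval p (((x / d : ℚ) : ℚ_[p]))⁻¹) := rfl

/-- The twisted height depends on `P` only through the rational number `x(P′) = minusTwistX P`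
(the point of the receptacle: no `√d` is adjoined). [cite: Silverman2005DivPoly, §5 Rem. 2] -/
theorem canonicalPAdicHeightSqMinusTwist_eq_of_minusTwistX_eq
    {P Q : (V.quadraticTwist d).toAffine.Point} (hP : P ≠ 0) (hQ : Q ≠ 0)
    (h : V.minusTwistX d P = V.minusTwistX d Q) :
    V.canonicalPAdicHeightSqMinusTwist p d P = V.canonicalPAdicHeightSqMinusTwist p d Q := by
  rcases P with _ | ⟨x₁, y₁, h₁⟩
  · exact absurd rfl hP
  rcases Q with _ | ⟨x₂, y₂, h₂⟩
  · exact absurd rfl hQ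
  simp only [minusTwistX_some] at h
  rw [canonicalPAdicHeightSqMinusTwist_some, canonicalPAdicHeightSqMinusTwist_some, h]

variable {V p d} in
/-- Unfolding `IsCanonicalSqMinusTwist` at an admissible point.
[cite: MazurSteinTate2006, §1 eq. (1.1)] -/
theorem PAdicHeightData.IsCanonicalSqMinusTwist.pairing_self_eq
    {D : PAdicHeightData (V.quadraticTwist d) p} (hD : D.IsCanonicalSqMinusTwist)
    {P : (V.quadraticTwist d).toAffine.Point} (hP : V.IsAdmissibleMinusTwist p d P) :
    D.pairing P P = V.canonicalPAdicHeightSqMinusTwist p d P :=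
  hD P hP

end MinusTwist

end WeierstrassCurve

end
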